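import Summits.BirchSwinnertonDyer.BirchSwinnertonDyer.Theorems.ByReductionTypeAtTwoAdditivePotGoodPrintKrizLi
import HarnessLib

/-!
# Route `GenusKolyvaginAtTwo`, crux U₂ `MinimalTwinBSDTwo` (stmt-BirchSwinnertonDyer-22985), LINE 23 «twin_swap»: THE KRIZ–LI ANCHOR ROAD KEYED ON
# THE WALL — `BSD(·, 2)` on the whole packet `{V^{(d)}, V^{(d·d_K)} : d ∈ 𝒩(V, K), χ_d(−N) = 1}` of a RANK-ONE (★)-anchor `V` of conductor `< 5000`
# from Creutz–Miller on the BASE ONLY, WALL row 1 on the rank-zero companion `V^{(d_K)}` (any conductor), and Kriz–Li Thm 5.1 (2) / 4.3 — base-generic,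
# field-generic; NO partner model, NO partner conductor, NO twin-Selmer or genus-budget hypothesis

Seat `bsd-line-gk2-p2` g34 (PROVER 2/3, cell `bsd-f1-sign2`; LINE 23 holder), `--supports stmt-BirchSwinnertonDyer-22985` (helper; closes nothing).
THEOREMS ONLY (0 `def`, 0 `sorry`); standard axioms.  HONEST FRAMING (D-0014/D-0036).  Context: the K4 seat's generic road
`AddPotGoodPrint.krizLi_bsdp_two_of_twist_of_conductor_lt` (cell `bsd-2adic`) takes BOTH numerical `BSD(2)` inputs of Kriz–Li Thm 5.1 (2) from
Creutz–Miller and therefore needs the companion `V^{(d_K)}` inside `N < 5000` — among Kriz–Li's 23 rank-one Table-1 anchors with `c₂` odd this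
holds for `37a1`, `43a1`, `92b1` only (`d_K²·N < 5000`; roads `…KrizLiAnchor37a1/43a1.lean`, `…PrintKrizLi92b1.lean`).  For the other twenty
anchors (`101a1`, `123a1/b1`, `124a1`, `131a1`, `141a1/d1`, `148a1`, `155a1/c1`, `163a1`, `172a1`, `189a1/b1`, `196a1`, `219a1/b1`, `91a1/b1`, `243a1`) the
companion is a NON-CM curve of ANALYTIC RANK ZERO (Kriz–Li Thm 4.3 at `d = 1`, given `r_an(V) = 1`), i.e. exactly a WALL row-1 curve of route
`ByReductionTypeAtTwo` — LINE 23's own anchor S1′.  This file is that road: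

* §1 `krizLi_analyticRank_partner_eq_zero_of_rankOne` (Thm 4.3 at `d = 1`: `r_an(V) = 1 ⇒ r_an(V^{(d_K)}) = 0`) and `not_hasCM_of_smul_quadraticTwist`
  (non-CM travels along every twist: same `j`).
* §2 `krizLi_bsdp_two_of_twist_of_conductor_lt_of_partner_bsdp` — the K4 road with the companion's `BSD(2)` DISPLAYED instead of taken from
  Creutz–Miller (`N(V) < 5000` still feeds the base).
* §3 ★ `krizLi_bsdp_two_of_twist_of_conductor_lt_of_wall` — **`BSDp W′ 2` at every global minimal `W′ ≅ V^{(d)}` or `V^{(d·d_K)}`**, `d ∈ 𝒩(V, K)`,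
  `χ_d(−N) = 1`, from: S1′ (`∀` non-CM `r_an = 0` ⟹ `BSD₂`, displayed), `N(V) < 5000`, `¬CM(V)`, `r_an(V) = 1`, `V(ℚ)[2] = 0`, the Heegner field, the
  (★)-datum, Kriz–Li's local clause; BY NAME Kriz–Li Thm 5.1 (2) / 4.3 and Creutz–Miller.  (S1′ is DISPLAYED as a hypothesis so that this file stays
  outside every route's Theses cone; feed it `Uniform.rankZeroBSDTwo_of_wallItems hOrd hMult hSS hAdd` — the four WALL row-1 items of route
  ByReductionTypeAtTwo, file `…UniformByName.lean` — to read it by name.)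
* §4 the U₂-keyed sorting: `rankOneMembers_of_wall` (`r_an(W₁) = 1 ∧ ¬CM ∧ BSDp W₁ 2` at `W₁ ≅ V^{(d)}` — U₂-class curves, settled MODULO THE WALL +
  PRINT + the anchor's (★) certificate, no LINE 23 research stub) and `rankZeroCompanions_of_wall`.

Compared with g29's packet door (`KrizLiPacket.bsdp_packet_of_wall_of_assumptionStar_twinTrivial_of_facts`: wall + PRINT + (★) + a `2`-Selmer-TRIVIAL twin
INSIDE THE GENUS BUDGET, deriving `BSD₂(V)` through g24's (★)-door), this road takes `BSD₂(V)` from Creutz–Miller (every Table-1 anchor has `N ≤ 248`)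
and so needs NO Selmer or budget clause on the twin and NO Gross–Zagier / Milne input.  PRESEARCH: the transport is [corpus: doi-10-1017-fms-2019-9,
Thm. 5.1 (2), p. 30 L43–50]; Rem. 5.2 says both `BSD(2)` inputs come from numerical verification — feeding the companion's from a rank-zero CLASS
statement (the wall) is the cell's composition (g29), not in print; corollary-of-tree.  **BSD is NOT proved by any of this; U₂ is NOT proved; the wall is
OPEN; no item is closed.**

References: [KrizLi2019] Thm 5.1 (2) (FMS VoR p. 30) = arXiv:1606.03172 Thm 1.12, Thm 4.3, Def 4.1, Rem. 5.2, §6 Ex. 6.2 and Table 1;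
[CreutzMiller2012] Thm 1.1; [Miller2011LMS] Def 1.1; [SilvermanAEC2009] X.5, App. C §11.
-/

set_option autoImplicit false
-- the Theorems namespace of this sub repeats the summit name by design (D-0017 nested layout)
set_option linter.dupNamespace false

noncomputable section

open scoped Classical

open WeierstrassCurve NumberField Literature.NumberTheory.EllipticCurves
  Literature.NumberTheory.EllipticCurves.ModularForms
  Literature.NumberTheory.EllipticCurves.Rank1Residual
  Literature.NumberTheory.EllipticCurves.Rank1Residual.Typed
  Summit.BirchSwinnertonDyer.Rank1Residual
  Summit.BirchSwinnertonDyer.Rank1Residual.P2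
  Summit.BirchSwinnertonDyer.BirchSwinnertonDyer.Theorems.AddPotGoodPrint

namespace Summit.BirchSwinnertonDyer.BirchSwinnertonDyer.Theorems.GenusExact.TwinSwap.KrizLiAnchorWall

variable (V : WeierstrassCurve ℚ) [V.IsElliptic] [V.IsGloballyMinimal] [NeZero (V.conductorNorm ℤ)]

/-! ## §1 The companion of a rank-one (★)-anchor has analytic rank zero; non-CM travels along twists -/

/-- **The companion `W₀ ≅ V^{(d_K)}` has analytic rank `0` when the anchor has analytic rank `1`** (Kriz–Li Thm 4.3 at `d = 1`: the pair
`(V^{(1)}, V^{(d_K)})` has ranks `{0, 1}` and `r_an(V^{(1)}) = r_an(V)`). [cite: KrizLi2019, Thm. 4.3 (FMS) = arXiv:1606.03172 Thm. 3.3; §6 Example 6.2] -/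
theorem krizLi_analyticRank_partner_eq_zero_of_rankOne (h33 : KrizLi2019.thm33_rank_twist)
    (h2 : ∀ Q : V.toAffine.Point, 2 • Q = 0 → Q = 0)
    (K : Type) [Field K] [NumberField K] (hK : IsImaginaryQuadratic K) (hH : SatisfiesHeegnerHypothesis (V.conductorNorm ℤ) K)
    (Dt : ModularParametrizationData V (V.conductorNorm ℤ)) (H : HeegnerDatum (V.conductorNorm ℤ) (NumberField.discr K))
    (ι : K →+* ℂ) (P : (V.baseChange K).toAffine.Point) (hP : WeierstrassCurve.Affine.Point.map ι.toRatAlgHom P = heegnerPointComplex Dt H)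
    (j : K →ₐ[ℚ] ℚ_[2]) (hstar : KrizLi2019.AssumptionStar V Dt K P j) (hr : V.analyticRank = 1)
    (W₀ : WeierstrassCurve ℚ) [W₀.IsElliptic] [W₀.IsGloballyMinimal]
    (hW₀ : ∃ C : VariableChange ℚ, C • V.quadraticTwist (NumberField.discr K : ℚ) = W₀) : W₀.analyticRank = 0 := by
  obtain ⟨W₁, _, _, hW₁⟩ := exists_globallyMinimal_twist V (d := (1 : ℚ)) one_ne_zero
  obtain ⟨hor, heq⟩ := analyticRank_dichotomy_of_assumptionStar V h33 h2 K hK hH Dt H ι P hP j hstar W₁ W₀ hW₁ hW₀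
  omega

omit [V.IsGloballyMinimal] [NeZero (V.conductorNorm ℤ)] in
/-- **Non-CM travels along the packet**: every `ℚ`-model of a quadratic twist of a non-CM `V` is non-CM (same `j`-invariant).
[cite: SilvermanAEC2009, App. C §11 and X.5] -/
theorem not_hasCM_of_smul_quadraticTwist (hcm : ¬ V.HasCM) {d : ℚ} (hd : d ≠ 0) (W : WeierstrassCurve ℚ) [W.IsElliptic]
    (hW : ∃ C : VariableChange ℚ, C • V.quadraticTwist d = W) : ¬ W.HasCM := by
  obtain ⟨C, rfl⟩ := hW
  haveI := V.isElliptic_quadraticTwist hd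
  have hj : (C • V.quadraticTwist d).j = V.j := by rw [variableChange_j, j_quadraticTwist V hd]
  rw [hasCM_iff_of_j_eq hj]
  exact hcm

/-! ## §2 The road with the companion's `BSD(2)` displayed -/

/-- **`BSD(W′, 2)` at every global minimal `W′ ≅ V^{(d)}` or `≅ V^{(d·d_K)}`, `d ∈ 𝒩(V, K)`, `χ_d(−N) = 1`, the companion's `BSD(2)` DISPLAYED**
(`hbsd₀ : BSDp W₀ 2` at ONE global minimal `W₀ ≅ V^{(d_K)}`); the base's `BSD(2)` from Creutz–Miller (`N(V) < 5000`, `r_an(V) ≤ 1` by Thm 4.3);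
Kriz–Li's hypotheses (`V(ℚ)[2] = 0`, Heegner field, (★)-datum, `c₂` odd / Manin clause) as in the K4 road. BY NAME: Thm 5.1 (2) (`hKL`), Thm 4.3
(`h33`), Creutz–Miller (`hS31`). BSD is not proved by any of this. [cite: KrizLi2019, Thm. 5.1 (2) and Thm. 4.3] [cite: CreutzMiller2012, Thm. 1.1] -/
theorem krizLi_bsdp_two_of_twist_of_conductor_lt_of_partner_bsdp (hKL : KrizLi2019.thm112_bsdTwo_twist)
    (h33 : KrizLi2019.thm33_rank_twist) (hS31 : bsdTriple_of_analyticRank_le_one_of_conductor_lt) (hN : V.conductorNorm ℤ < 5000)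
    (h2 : ∀ Q : V.toAffine.Point, 2 • Q = 0 → Q = 0)
    (K : Type) [Field K] [NumberField K] (hK : IsImaginaryQuadratic K) (hH : SatisfiesHeegnerHypothesis (V.conductorNorm ℤ) K)
    (Dt : ModularParametrizationData V (V.conductorNorm ℤ)) (H : HeegnerDatum (V.conductorNorm ℤ) (NumberField.discr K))
    (ι : K →+* ℂ) (P : (V.baseChange K).toAffine.Point) (hP : WeierstrassCurve.Affine.Point.map ι.toRatAlgHom P = heegnerPointComplex Dt H)
    (j : K →ₐ[ℚ] ℚ_[2]) (hstar : KrizLi2019.AssumptionStar V Dt K P j)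
    (hloc : (haveI : Fact (2 : ℕ).Prime := ⟨Nat.prime_two⟩;
      Odd ((V.baseChange ℚ_[2]).localTamagawaNumber ℤ_[2]) ∧
        (¬ V.HasGoodReductionAtPrime 2 → ¬ V.HasMultiplicativeReductionAtPrime 2 → Odd Dt.c)))
    (W₀ : WeierstrassCurve ℚ) [W₀.IsElliptic] [W₀.IsGloballyMinimal]
    (hW₀ : ∃ C : VariableChange ℚ, C • V.quadraticTwist (NumberField.discr K : ℚ) = W₀) (hbsd₀ : BSDp W₀ 2)
    {d : ℤ} (hd : KrizLi2019.InN V K d) (hsign : Int.sign d * jacobiSym (V.conductorNorm ℤ) d.natAbs = 1)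
    (W' : WeierstrassCurve ℚ) [W'.IsElliptic] [W'.IsGloballyMinimal]
    (hW' : (∃ C : VariableChange ℚ, C • V.quadraticTwist (d : ℚ) = W') ∨
      (∃ C : VariableChange ℚ, C • V.quadraticTwist ((d * NumberField.discr K : ℤ) : ℚ) = W')) :
    BSDp W' 2 := by
  have hD : (NumberField.discr K : ℚ) ≠ 0 := by exact_mod_cast NumberField.discr_ne_zero K
  have hbase : BSDp V 2 := krizLi_bsdp_two_base_of_conductor_lt V h33 hS31 hN h2 K hK hH Dt H ι P hP j hstar
  have hd0 : (d : ℚ) ≠ 0 := cast_ne_zero_of_inN V hd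
  have hdK : ((d * NumberField.discr K : ℤ) : ℚ) ≠ 0 := by push_cast; exact mul_ne_zero hd0 hD
  rcases hW' with hW' | hW'
  · obtain ⟨W₂, _, _, hW₂⟩ := exists_globallyMinimal_twist V hdK
    exact (bsdp_two_twists_of_krizLi hKL h2 K hK hH Dt H ι P hP j hstar hloc hW₀ hbase hbsd₀ d hd hsign
      (W₁ := W') (W₂ := W₂) hW' hW₂).1
  · obtain ⟨W₁, _, _, hW₁⟩ := exists_globallyMinimal_twist V hd0
    exact (bsdp_two_twists_of_krizLi hKL h2 K hK hH Dt H ι P hP j hstar hloc hW₀ hbase hbsd₀ d hd hsign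
      (W₁ := W₁) (W₂ := W') hW₁ hW').2

/-! ## §3 The road keyed on the wall -/

/-- ★ **THE KRIZ–LI ANCHOR ROAD KEYED ON THE WALL — `BSD(W′, 2)` at every global minimal `W′ ≅ V^{(d)}` or `≅ V^{(d·d_K)}`, `d ∈ 𝒩(V, K)`,
`χ_d(−N) = 1`**, from S1′ (`hS1`: `BSD₂` for every non-CM global minimal curve of analytic rank `0` — WALL row 1), `N(V) < 5000` (Creutz–Miller on
the base), `¬CM(V)`, `r_an(V) = 1`, `V(ℚ)[2] = 0`, the Heegner field, the (★)-datum and Kriz–Li's local clause.  The companion `V^{(d_K)}` is handled by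
the wall: it is non-CM (§1) of analytic rank `0` (§1).  BY NAME: Thm 5.1 (2), Thm 4.3, Creutz–Miller.  CONDITIONAL on `hS1`; BSD is not proved by any
of this. [cite: KrizLi2019, Thm. 5.1 (2) and Thm. 4.3; Rem. 5.2] [cite: CreutzMiller2012, Thm. 1.1] -/
theorem krizLi_bsdp_two_of_twist_of_conductor_lt_of_wall (hKL : KrizLi2019.thm112_bsdTwo_twist)
    (h33 : KrizLi2019.thm33_rank_twist) (hS31 : bsdTriple_of_analyticRank_le_one_of_conductor_lt)
    (hS1 : ∀ (W : WeierstrassCurve ℚ) [W.IsElliptic] [W.IsGloballyMinimal], ¬ W.HasCM → W.analyticRank = 0 → BSDp W 2)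
    (hN : V.conductorNorm ℤ < 5000) (hcm : ¬ V.HasCM) (hr : V.analyticRank = 1)
    (h2 : ∀ Q : V.toAffine.Point, 2 • Q = 0 → Q = 0)
    (K : Type) [Field K] [NumberField K] (hK : IsImaginaryQuadratic K) (hH : SatisfiesHeegnerHypothesis (V.conductorNorm ℤ) K)
    (Dt : ModularParametrizationData V (V.conductorNorm ℤ)) (H : HeegnerDatum (V.conductorNorm ℤ) (NumberField.discr K))
    (ι : K →+* ℂ) (P : (V.baseChange K).toAffine.Point) (hP : WeierstrassCurve.Affine.Point.map ι.toRatAlgHom P = heegnerPointComplex Dt H)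
    (j : K →ₐ[ℚ] ℚ_[2]) (hstar : KrizLi2019.AssumptionStar V Dt K P j)
    (hloc : (haveI : Fact (2 : ℕ).Prime := ⟨Nat.prime_two⟩;
      Odd ((V.baseChange ℚ_[2]).localTamagawaNumber ℤ_[2]) ∧
        (¬ V.HasGoodReductionAtPrime 2 → ¬ V.HasMultiplicativeReductionAtPrime 2 → Odd Dt.c)))
    {d : ℤ} (hd : KrizLi2019.InN V K d) (hsign : Int.sign d * jacobiSym (V.conductorNorm ℤ) d.natAbs = 1)
    (W' : WeierstrassCurve ℚ) [W'.IsElliptic] [W'.IsGloballyMinimal]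
    (hW' : (∃ C : VariableChange ℚ, C • V.quadraticTwist (d : ℚ) = W') ∨
      (∃ C : VariableChange ℚ, C • V.quadraticTwist ((d * NumberField.discr K : ℤ) : ℚ) = W')) :
    BSDp W' 2 := by
  have hD : (NumberField.discr K : ℚ) ≠ 0 := by exact_mod_cast NumberField.discr_ne_zero K
  obtain ⟨W₀, _, _, hW₀⟩ := exists_globallyMinimal_twist V hD
  have hr0 : W₀.analyticRank = 0 :=
    krizLi_analyticRank_partner_eq_zero_of_rankOne V h33 h2 K hK hH Dt H ι P hP j hstar hr W₀ hW₀
  have hcm0 : ¬ W₀.HasCM := not_hasCM_of_smul_quadraticTwist V hcm hD W₀ hW₀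
  exact krizLi_bsdp_two_of_twist_of_conductor_lt_of_partner_bsdp V hKL h33 hS31 hN h2 K hK hH Dt H ι P hP j hstar hloc W₀ hW₀
    (hS1 W₀ hcm0 hr0) hd hsign W' hW'

/-! ## §4 The U₂-keyed sorting: rank-one members and rank-zero companions -/

/-- **THE RANK-ONE MEMBERS `V^{(d)}` — U₂-CLASS CURVES SETTLED MODULO THE WALL + PRINT + the anchor's (★)**: at every global minimal `W₁ ≅ V^{(d)}`
(`d ∈ 𝒩(V, K)`, `χ_d(−N) = 1`): `r_an(W₁) = 1 ∧ ¬CM ∧ BSD(W₁, 2)`.  BSD is not proved by any of this; U₂ is not proved.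
[cite: KrizLi2019, Thm. 5.1 (2), Thm. 4.3, Thm. 1.4] [cite: CreutzMiller2012, Thm. 1.1] -/
theorem rankOneMembers_of_wall (hKL : KrizLi2019.thm112_bsdTwo_twist)
    (h33 : KrizLi2019.thm33_rank_twist) (hS31 : bsdTriple_of_analyticRank_le_one_of_conductor_lt)
    (hS1 : ∀ (W : WeierstrassCurve ℚ) [W.IsElliptic] [W.IsGloballyMinimal], ¬ W.HasCM → W.analyticRank = 0 → BSDp W 2)
    (hN : V.conductorNorm ℤ < 5000) (hcm : ¬ V.HasCM) (hr : V.analyticRank = 1)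
    (h2 : ∀ Q : V.toAffine.Point, 2 • Q = 0 → Q = 0)
    (K : Type) [Field K] [NumberField K] (hK : IsImaginaryQuadratic K) (hH : SatisfiesHeegnerHypothesis (V.conductorNorm ℤ) K)
    (Dt : ModularParametrizationData V (V.conductorNorm ℤ)) (H : HeegnerDatum (V.conductorNorm ℤ) (NumberField.discr K))
    (ι : K →+* ℂ) (P : (V.baseChange K).toAffine.Point) (hP : WeierstrassCurve.Affine.Point.map ι.toRatAlgHom P = heegnerPointComplex Dt H)
    (j : K →ₐ[ℚ] ℚ_[2]) (hstar : KrizLi2019.AssumptionStar V Dt K P j)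
    (hloc : (haveI : Fact (2 : ℕ).Prime := ⟨Nat.prime_two⟩;
      Odd ((V.baseChange ℚ_[2]).localTamagawaNumber ℤ_[2]) ∧
        (¬ V.HasGoodReductionAtPrime 2 → ¬ V.HasMultiplicativeReductionAtPrime 2 → Odd Dt.c)))
    {d : ℤ} (hd : KrizLi2019.InN V K d) (hsign : Int.sign d * jacobiSym (V.conductorNorm ℤ) d.natAbs = 1)
    (W₁ : WeierstrassCurve ℚ) [W₁.IsElliptic] [W₁.IsGloballyMinimal]
    (hW₁ : ∃ C : VariableChange ℚ, C • V.quadraticTwist (d : ℚ) = W₁) :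
    W₁.analyticRank = 1 ∧ ¬ W₁.HasCM ∧ BSDp W₁ 2 := by
  have hB : BSDp W₁ 2 := krizLi_bsdp_two_of_twist_of_conductor_lt_of_wall V hKL h33 hS31 hS1 hN hcm hr h2 K hK hH Dt H ι P hP j hstar hloc
    hd hsign W₁ (Or.inl hW₁)
  have hD : (NumberField.discr K : ℚ) ≠ 0 := by exact_mod_cast NumberField.discr_ne_zero K
  have hd0 : (d : ℚ) ≠ 0 := cast_ne_zero_of_inN V hd
  have hdK0 : ((d * NumberField.discr K : ℤ) : ℚ) ≠ 0 := by push_cast; exact mul_ne_zero hd0 hD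
  obtain ⟨W₂, _, _, hW₂⟩ := exists_globallyMinimal_twist V hdK0
  obtain ⟨-, heq⟩ := krizLi_analyticRank_twists V h33 h2 K hK hH Dt H ι P hP j hstar hd hsign W₁ W₂ hW₁ hW₂
  exact ⟨by rw [heq, hr], not_hasCM_of_smul_quadraticTwist V hcm hd0 W₁ hW₁, hB⟩

/-- **THE RANK-ZERO COMPANIONS `V^{(d·d_K)}` — WALL ROW-1 INSTANCES**: at every global minimal `W₂ ≅ V^{(d·d_K)}` (`d ∈ 𝒩(V, K)`, `χ_d(−N) = 1`):
`r_an(W₂) = 0 ∧ ¬CM ∧ BSD(W₂, 2)` (the last granted the wall).  BSD is not proved by any of this.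
[cite: KrizLi2019, Thm. 5.1 (2), Thm. 4.3] [cite: CreutzMiller2012, Thm. 1.1] -/
theorem rankZeroCompanions_of_wall (hKL : KrizLi2019.thm112_bsdTwo_twist)
    (h33 : KrizLi2019.thm33_rank_twist) (hS31 : bsdTriple_of_analyticRank_le_one_of_conductor_lt)
    (hS1 : ∀ (W : WeierstrassCurve ℚ) [W.IsElliptic] [W.IsGloballyMinimal], ¬ W.HasCM → W.analyticRank = 0 → BSDp W 2)
    (hN : V.conductorNorm ℤ < 5000) (hcm : ¬ V.HasCM) (hr : V.analyticRank = 1)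
    (h2 : ∀ Q : V.toAffine.Point, 2 • Q = 0 → Q = 0)
    (K : Type) [Field K] [NumberField K] (hK : IsImaginaryQuadratic K) (hH : SatisfiesHeegnerHypothesis (V.conductorNorm ℤ) K)
    (Dt : ModularParametrizationData V (V.conductorNorm ℤ)) (H : HeegnerDatum (V.conductorNorm ℤ) (NumberField.discr K))
    (ι : K →+* ℂ) (P : (V.baseChange K).toAffine.Point) (hP : WeierstrassCurve.Affine.Point.map ι.toRatAlgHom P = heegnerPointComplex Dt H)
    (j : K →ₐ[ℚ] ℚ_[2]) (hstar : KrizLi2019.AssumptionStar V Dt K P j)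
    (hloc : (haveI : Fact (2 : ℕ).Prime := ⟨Nat.prime_two⟩;
      Odd ((V.baseChange ℚ_[2]).localTamagawaNumber ℤ_[2]) ∧
        (¬ V.HasGoodReductionAtPrime 2 → ¬ V.HasMultiplicativeReductionAtPrime 2 → Odd Dt.c)))
    {d : ℤ} (hd : KrizLi2019.InN V K d) (hsign : Int.sign d * jacobiSym (V.conductorNorm ℤ) d.natAbs = 1)
    (W₂ : WeierstrassCurve ℚ) [W₂.IsElliptic] [W₂.IsGloballyMinimal]
    (hW₂ : ∃ C : VariableChange ℚ, C • V.quadraticTwist ((d * NumberField.discr K : ℤ) : ℚ) = W₂) :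
    W₂.analyticRank = 0 ∧ ¬ W₂.HasCM ∧ BSDp W₂ 2 := by
  have hB : BSDp W₂ 2 := krizLi_bsdp_two_of_twist_of_conductor_lt_of_wall V hKL h33 hS31 hS1 hN hcm hr h2 K hK hH Dt H ι P hP j hstar hloc
    hd hsign W₂ (Or.inr hW₂)
  have hD : (NumberField.discr K : ℚ) ≠ 0 := by exact_mod_cast NumberField.discr_ne_zero K
  have hd0 : (d : ℚ) ≠ 0 := cast_ne_zero_of_inN V hd
  have hdK0 : ((d * NumberField.discr K : ℤ) : ℚ) ≠ 0 := by push_cast; exact mul_ne_zero hd0 hD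
  obtain ⟨W₁, _, _, hW₁⟩ := exists_globallyMinimal_twist V hd0
  obtain ⟨hor, heq⟩ := krizLi_analyticRank_twists V h33 h2 K hK hH Dt H ι P hP j hstar hd hsign W₁ W₂ hW₁ hW₂
  have hr2 : W₂.analyticRank = 0 := by omega
  exact ⟨hr2, not_hasCM_of_smul_quadraticTwist V hcm hdK0 W₂ hW₂, hB⟩

end Summit.BirchSwinnertonDyer.BirchSwinnertonDyer.Theorems.GenusExact.TwinSwap.KrizLiAnchorWall

end
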